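import Literature.Analysis.FunctionSpaces.TorusLinearisedNSForcedEnergy
import Literature.Analysis.FluidPDE.PassiveScalarHalfOpenExistence
import Literature.Analysis.FluidPDE.TorusHeatForcedIcc
import HarnessLib

/-!
# Parallel (streamwise-invariant) data under the Navier–Stokes equations linearised at a
# parallel shear flow: reduction to the heat equation

Analysis/FluidPDE proof file (theorems only; no definitions, no named facts).

Let `u(t, x) = U(t, x) eᵢ` be a jointly smooth PARALLEL SHEAR background on `[a, b] × 𝕋^d`:
pointing along the `i`-th axis (`u = (u·eᵢ) eᵢ`) and invariant under the translations along that
axis (`u(t, x + s eᵢ) = u(t, x)`), e.g. the Kolmogorov flow, or the field of the sawtooth pulse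
cascade on each half-slot (`SawtoothCascade.CascadeParams.field_eq_smul_single_of_mem_H/V`).
For the Navier–Stokes equations LINEARISED at `u` (Temam 1997, Ch. VI §3.1 (3.7)–(3.10);
Constantin–Foias 1988, Ch. 14 (14.3): `∂ₜw + (u·∇)w + (w·∇)u = νΔw − ∇q`, `div w = 0`, in the
tree's unbundled classical form of `FunctionSpaces/TorusLinearisedNSEnergy`), data that are
themselves parallel and streamwise-invariant, `w₀ = g eᵢ` with `g(x + s eᵢ) = g(x)`, evolve by
the HEAT EQUATION: `(w, q) = (θ eᵢ, 0)` with `∂ₜθ = νΔθ`, `θ(a) = g` — both advection terms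
vanish identically (`(u·∇)w = U ∂ᵢθ eᵢ = 0`, `(w·∇)u = θ ∂ᵢu = 0`) and `div w = ∂ᵢθ = 0`. This is
the streamwise (`k = 0`) block of the mode-by-mode decoupling of linear evolutions about shear
flows (Bedrossian–Coti Zelati 2017, §1: `P_k` "the projection to the `k`-th Fourier mode in `x`";
Drazin 2002, Ex. 8.8: `x`-independent perturbations of a parallel flow), recorded here in the
kernel's classical vocabulary for the cell `ad-ideate` (route `SawtoothPulseCascade`, crux
`ApproxSol58`: the heat-lag injections of the cascade are parallel comb data, and their
realignment to the injection times uses exactly this reduction together with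
`Torus.linearisedNS_unique`).

Main results (general `d`, axis `i`):

* `Torus.linearisedNS_of_parallel_heat` — if `θ` is jointly smooth, streamwise-invariant and
  solves `∂ₜθ = νΔθ + φ` on `[a, b]` (one-sided time derivative), then `w = θ eᵢ`, `q = 0` solve
  the linearised system with source `φ eᵢ` along ANY jointly smooth parallel shear background
  `u ∥ eᵢ`; `Torus.isDivFree_smul_single_of_forall_add_single` — such `w(t)` are divergence free;
* `Torus.exists_parallel_heat` — for `ν > 0`, `a < b` and a smooth streamwise-invariant `g` there
  is a jointly smooth streamwise-invariant solution of `∂ₜθ = νΔθ` on `[a, b] × 𝕋^d` with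
  `θ(a) = g` (the tree's classical advection–diffusion well-posedness with zero drift, Krylov 1996
  Thm 9.2.3 as discharged in `PassiveScalarWellPosednessProofs`, translated in time; invariance by
  uniqueness), which is moreover a classical transported scalar along `u` itself
  (`IsClassicalScalarTransportOn (Icc a b) ν u θ`: the advection term vanishes);
* `Torus.exists_linearisedNS_parallel` / `Torus.linearisedNS_parallel_unique` — hence the
  classical linearised solution from `g eᵢ` at time `a` exists, is `θ eᵢ` with zero pressure, and
  every classical linearised solution `(w, q)` along `u` on `[a, b]` with `w(a) = g eᵢ` equals it
  (`Torus.linearisedNS_unique`).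

## Mathlib / tree search

Tree (reused): `Torus.linearisedNS_unique` (`FunctionSpaces/TorusLinearisedNSEnergy`),
`Torus.exists_isClassicalScalarTransportOn_Icc`, `Torus.IsClassicalScalarTransportOn.eq_of_eq`
(`FluidPDE/PassiveScalarHalfOpenExistence`), `Torus.IsSmoothSpaceTimeOn.comp_add_const`,
`Torus.timeDerivWithin_comp_add_const` (`FluidPDE/TorusHeatForcedIcc`), `Torus.partialDeriv_smul`,
`Torus.laplacian_comp_add_right` / `Torus.gradient_comp_add_right` (`PressureBesovRegularity` /
`LerayHopfGalileanTorusTools`; private copies here to keep the import cone small),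
`Torus.fderiv_apply_eq_sum_partialDeriv`, `Torus.laplacian_eq_sum_partialDeriv_partialDeriv`
(`TorusCalculusProofs`). Searched `parallel.*linearised|shear.*heat|streamwise.*linearisedNS`
(`lean search`): only the energy/shear files `TorusLinearisedNSShear`, `KolmogorovShearLinearised`
(Fourier kernel of the steady operator) — no reduction lemma for parallel data.

## References

* R. Temam, *Infinite-Dimensional Dynamical Systems in Mechanics and Physics*, 2nd ed. (1997),
  Ch. VI §3.1 (3.7)–(3.10). [`Temam1997`]
* J. Bedrossian, M. Coti Zelati, *Enhanced dissipation, hypoellipticity, and anomalous small noise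
  inviscid limits in shear flows*, ARMA 224 (2017), §1 (held: `paper:arxiv-1510.08098`, p. 3).
  [`BedrossianCotiZelati2017`]
* P. G. Drazin, *Introduction to Hydrodynamic Stability* (2002), Ex. 8.8 (held:
  `book:drazin2002-introduction-hydrodynamic-stability`, p. 143). [`Drazin2002`]
-/

noncomputable section

open MeasureTheory Set Filter Function
open scoped ContDiff InnerProductSpace RealInnerProductSpace Topology

namespace Literature.Analysis.FluidPDE

open Literature.Analysis.FunctionSpaces

variable {d : Type*} [Fintype d] [DecidableEq d]

/-! ### Calculus of parallel fields `θ eᵢ` and of streamwise-invariant functions -/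

section Parallel

variable {F : Type*} [NormedAddCommGroup F] [NormedSpace ℝ F]

omit [Fintype d] in
/-- The coordinate line through `x` in direction `eᵢ` is the axis translate by `Pi.single i ↑t`.
[folklore] -/
private theorem proj_smul_single (i : d) (t : ℝ) :
    Torus.proj (t • EuclideanSpace.single i (1 : ℝ)) =
      (Pi.single i ((t : ℝ) : UnitAddCircle) : UnitAddTorus d) := by
  funext j
  rw [Torus.proj_apply, PiLp.smul_apply, EuclideanSpace.single, PiLp.single_apply]
  by_cases hj : j = i
  · subst hj; simp
  · simp [hj]

omit [Fintype d] in
/-- A function invariant under the translations along the `i`-th axis has `∂ᵢ = 0` (the difference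
quotient along `eᵢ` vanishes identically). [cite: Evans2010, App. A.3 (partial derivatives)] -/
theorem Torus.partialDeriv_eq_zero_of_forall_add_single {i : d} {β : UnitAddTorus d → F}
    (hβ : ∀ (s : UnitAddCircle) (x : UnitAddTorus d), β (x + Pi.single i s) = β x)
    (x : UnitAddTorus d) : Torus.partialDeriv i β x = 0 := by
  have h : (fun t : ℝ => β (x + Torus.proj (t • EuclideanSpace.single i (1 : ℝ)))) = fun _ => β x := by
    funext t; rw [proj_smul_single, hβ]
  simp only [Torus.partialDeriv, Torus.lineDeriv, h, deriv_const]

/-- Partial derivatives of a parallel field: `∂ⱼ(θ e) = (∂ⱼθ) e` for a fixed vector `e` (Leibniz rule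
with a constant factor). [cite: Evans2010, App. A.3 (partial derivatives, Leibniz rule)] -/
theorem Torus.partialDeriv_smul_const_of_isContDiff {θ : UnitAddTorus d → ℝ} (hθ : Torus.IsContDiff 1 θ)
    (e : F) (j : d) (x : UnitAddTorus d) :
    Torus.partialDeriv j (fun y => θ y • e) x = (Torus.partialDeriv j θ x) • e := by
  rw [Torus.partialDeriv_smul hθ (Torus.isContDiff_const e) j x]
  have h0 : Torus.partialDeriv j (fun _ : UnitAddTorus d => e) x = 0 := by
    simp [Torus.partialDeriv, Torus.lineDeriv]
  rw [h0, smul_zero, zero_add]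

/-- The Laplacian of a parallel field: `Δ(θ e) = (Δθ) e` (`Δ = ∑ᵢ ∂ᵢ∂ᵢ` componentwise).
[cite: Evans2010, App. A.3 (Δu = ∑ u_{x_i x_i})] -/
theorem Torus.laplacian_smul_const_of_isSmooth {θ : UnitAddTorus d → ℝ} (hθ : Torus.IsSmooth θ)
    (e : F) (x : UnitAddTorus d) :
    Torus.laplacian (fun y => θ y • e) x = (Torus.laplacian θ x) • e := by
  have hθe : Torus.IsSmooth (fun y => θ y • e) := hθ.smul' (Torus.isSmooth_const e)
  rw [Torus.laplacian_eq_sum_partialDeriv_partialDeriv hθe,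
    Torus.laplacian_eq_sum_partialDeriv_partialDeriv hθ, Finset.sum_smul]
  refine Finset.sum_congr rfl fun j _ => ?_
  have h1 : Torus.partialDeriv j (fun y => θ y • e) = fun y => (Torus.partialDeriv j θ y) • e := by
    funext y
    exact Torus.partialDeriv_smul_const_of_isContDiff (hθ.isContDiff (by simp)) e j y
  rw [h1]
  exact Torus.partialDeriv_smul_const_of_isContDiff ((hθ.partialDeriv j).isContDiff (by simp)) e j x

/-- The convective derivative along a field PARALLEL to `eᵢ` is `(v·eᵢ) ∂ᵢ`:
`((v·∇)a)(x) = c ∂ᵢa(x)` when `v(x) = c eᵢ` (e.g. `c = vᵢ(x)`): the directional derivative along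
`c eᵢ`. [cite: Evans2010, App. A.3 (Du · v, directional derivatives)] -/
theorem Torus.convect_of_parallel {v : UnitAddTorus d → EuclideanSpace ℝ d} {a : UnitAddTorus d → F}
    (ha : Torus.IsContDiff 1 a) (i : d) {x : UnitAddTorus d} {c : ℝ}
    (hv : v x = c • EuclideanSpace.single i (1 : ℝ)) :
    Torus.convect v a x = c • Torus.partialDeriv i a x := by
  rw [Torus.convect, hv, map_smul, Torus.partialDeriv_eq_fderiv_apply ha]

/-- The divergence of a parallel field: `div (θ eᵢ) = ∂ᵢθ`. [cite: Evans2010, App. A.3 (div u = ∑ u^i_{x_i})] -/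
theorem Torus.divergence_smul_single (θ : UnitAddTorus d → ℝ) (i : d) (x : UnitAddTorus d) :
    Torus.divergence (fun y => θ y • EuclideanSpace.single i (1 : ℝ)) x = Torus.partialDeriv i θ x := by
  unfold Torus.divergence
  have hcomp : ∀ j : d, (fun y => (θ y • EuclideanSpace.single i (1 : ℝ)) j) =
      fun y => θ y * (if j = i then 1 else 0) := by
    intro j; funext y
    rw [PiLp.smul_apply, EuclideanSpace.single, PiLp.single_apply, smul_eq_mul]
  simp_rw [hcomp]
  rw [Finset.sum_eq_single i]
  · simp only [if_true, mul_one]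
  · intro j _ hj
    simp only [if_neg hj, mul_zero]
    simp [Torus.partialDeriv, Torus.lineDeriv]
  · intro h; exact absurd (Finset.mem_univ i) h

/-- `div (θ eᵢ) = ∂ᵢθ = 0` when `θ` is invariant along the `i`-th axis: parallel streamwise-invariant
fields are incompressible (Drazin 2002, Ex. 8.8: `x`-independent perturbations).
[cite: Drazin2002, Ex. 8.8 (x-independent perturbations of a parallel flow)] -/
theorem Torus.isDivFree_smul_single_of_forall_add_single {θ : UnitAddTorus d → ℝ} {i : d}
    (hinv : ∀ (s : UnitAddCircle) (x : UnitAddTorus d), θ (x + Pi.single i s) = θ x) :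
    Torus.IsDivFree (fun y => θ y • EuclideanSpace.single i (1 : ℝ)) := fun x => by
  rw [Torus.divergence_smul_single θ i x, Torus.partialDeriv_eq_zero_of_forall_add_single hinv]

/-- A parallel shear flow `u = U eᵢ` with `U` independent of `xᵢ` is divergence free (Drazin 2002 §8.1:
plane parallel flows are exact incompressible flows). [cite: Drazin2002, §8.1 (plane parallel flow U(z) i)] -/
theorem Torus.isDivFree_of_parallel_of_forall_add_single {v : UnitAddTorus d → EuclideanSpace ℝ d} {i : d}
    (hdir : ∀ x, v x = (v x i) • EuclideanSpace.single i (1 : ℝ))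
    (hinv : ∀ (s : UnitAddCircle) (x : UnitAddTorus d), v (x + Pi.single i s) = v x) :
    Torus.IsDivFree v := by
  have hfun : v = fun y => (v y i) • EuclideanSpace.single i (1 : ℝ) := funext hdir
  rw [hfun]
  exact Torus.isDivFree_smul_single_of_forall_add_single fun s x => by
    simp only [hinv s x]

end Parallel

/-! ### Space translation of jointly smooth fields -/

section Translate

variable {F : Type*} [NormedAddCommGroup F] [NormedSpace ℝ F]

omit [DecidableEq d] in
/-- Joint smoothness is invariant under SPACE translation: if `w` is jointly smooth on `S × 𝕋^d`
then so is `(t, x) ↦ w(t, x + v)` (compose the space–time lift with `(t, y) ↦ (t, y + ṽ)`,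
`proj ṽ = v`; chain rule). [cite: Evans2010, App. A.3 (chain rule / change of variables)] -/
theorem _root_.Literature.Analysis.FunctionSpaces.Torus.IsSmoothSpaceTimeOn.comp_add_right_space
    {S : Set ℝ} {w : ℝ → UnitAddTorus d → F} (h : Torus.IsSmoothSpaceTimeOn S w) (v : UnitAddTorus d) :
    Torus.IsSmoothSpaceTimeOn S (fun t x => w t (x + v)) := by
  obtain ⟨y₀, rfl⟩ := Torus.proj_surjective v
  have hφ : ContDiff ℝ ∞ (fun z : ℝ × EuclideanSpace ℝ d => (z.1, z.2 + y₀)) :=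
    contDiff_fst.prodMk (contDiff_snd.add contDiff_const)
  have hmaps : MapsTo (fun z : ℝ × EuclideanSpace ℝ d => (z.1, z.2 + y₀)) (S ×ˢ univ) (S ×ˢ univ) :=
    fun z hz => ⟨hz.1, mem_univ _⟩
  have hfun : Torus.stLift (fun t x => w t (x + Torus.proj y₀)) =
      Torus.stLift w ∘ fun z : ℝ × EuclideanSpace ℝ d => (z.1, z.2 + y₀) := by
    funext ⟨t, y⟩
    simp only [Function.comp_apply, Torus.stLift_apply, Torus.proj_add]
  change ContDiffOn ℝ ∞ (Torus.stLift (fun t x => w t (x + Torus.proj y₀))) (S ×ˢ univ)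
  rw [hfun]
  exact h.comp hφ.contDiffOn hmaps

omit [Fintype d] [DecidableEq d] in
/-- The one-sided time derivative commutes with space translation (it is computed slice by
slice; definitional). [cite: Evans2010, App. A.3 (notation u_t)] -/
theorem Torus.timeDerivWithin_comp_add_right_space (S : Set ℝ) (w : ℝ → UnitAddTorus d → F)
    (v : UnitAddTorus d) (t : ℝ) (x : UnitAddTorus d) :
    Torus.timeDerivWithin S (fun s y => w s (y + v)) t x = Torus.timeDerivWithin S w t (x + v) := rfl

omit [DecidableEq d] in
/-- The Laplacian commutes with space translation: `Δ(f(· + v))(x) = (Δf)(x + v)` (private copy of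
`Torus.laplacian_comp_add_right` of `PressureBesovRegularity`, to keep the imports light). [folklore] -/
private theorem laplacian_comp_add_right' (f : UnitAddTorus d → F) (v x : UnitAddTorus d) :
    Torus.laplacian (fun y => f (y + v)) x = Torus.laplacian f (x + v) := by
  have h : Torus.liftAt (fun y => f (y + v)) x = Torus.liftAt f (x + v) := by
    funext w
    simp only [Torus.liftAt_apply, add_right_comm]
  simp only [Torus.laplacian, h]

omit [DecidableEq d] in
/-- The gradient commutes with space translation: `∇(θ(· + v))(x) = (∇θ)(x + v)` (private copy of
`Torus.gradient_comp_add_right` of `LerayHopfGalileanTorusTools`, to keep the imports light). [folklore] -/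
private theorem gradient_comp_add_right' (θ : UnitAddTorus d → ℝ) (v x : UnitAddTorus d) :
    Torus.gradient (fun y => θ (y + v)) x = Torus.gradient θ (x + v) := by
  have h : Torus.liftAt (fun y => θ (y + v)) x = Torus.liftAt θ (x + v) := by
    funext w
    simp only [Torus.liftAt_apply, add_right_comm]
  simp only [Torus.gradient, h]

/-- A classical transported scalar along a drift that is invariant under a space translation,
translated by it, is again a classical transported scalar (same window, same diffusivity): translation
invariance of `∂ₜ + b·∇ − κΔ` when `b(x + v) = b(x)`. [cite: Krylov1996, Thm. 9.2.3 (constant-coefficient part; translation invariance)] -/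
theorem Torus.IsClassicalScalarTransportOn.comp_add_right_space {S : Set ℝ} {κ : ℝ}
    {b : ℝ → UnitAddTorus d → EuclideanSpace ℝ d} {θ : ℝ → UnitAddTorus d → ℝ}
    (h : Torus.IsClassicalScalarTransportOn S κ b θ) (v : UnitAddTorus d)
    (hb : ∀ t ∈ S, ∀ x, b t (x + v) = b t x) :
    Torus.IsClassicalScalarTransportOn S κ b (fun t x => θ t (x + v)) := by
  refine ⟨h.smooth_velocity, h.smooth_scalar.comp_add_right_space v, fun t ht x => ?_, h.divFree⟩
  rw [Torus.timeDerivWithin_comp_add_right_space, gradient_comp_add_right',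
    laplacian_comp_add_right', ← hb t ht x]
  exact h.transport t ht (x + v)

end Translate

/-! ### The structure theorem: parallel streamwise-invariant data evolve by the heat equation -/

section Structure

variable {a b ν : ℝ} {i : d} {u : ℝ → UnitAddTorus d → EuclideanSpace ℝ d}
  {θ φ : ℝ → UnitAddTorus d → ℝ}

variable {F : Type*} [NormedAddCommGroup F] [NormedSpace ℝ F] in
omit [DecidableEq d] in
/-- The one-sided time derivative of a parallel field: `∂ₜ(θ e) = (∂ₜθ) e` (jointly smooth `θ`,
time set of unique differentiability; Leibniz with a constant vector). [cite: Evans2010, App. A.3 (u_t; Leibniz rule)] -/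
theorem Torus.timeDerivWithin_smul_const_of_isSmoothSpaceTimeOn {S : Set ℝ}
    (hθ : Torus.IsSmoothSpaceTimeOn S θ) (hS : UniqueDiffOn ℝ S) (e : F) {t : ℝ} (ht : t ∈ S)
    (x : UnitAddTorus d) :
    Torus.timeDerivWithin S (fun s y => θ s y • e) t x = (Torus.timeDerivWithin S θ t x) • e :=
  ((hθ.hasDerivWithinAt_slice ht x).smul_const e).derivWithin (hS t ht)

/-- **Parallel streamwise-invariant data under the linearised Navier–Stokes flow at a parallel
shear: the heat equation.** Let `u` be a jointly smooth PARALLEL SHEAR background along the `i`-th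
axis on `[a, b] × 𝕋^d` (`u = (u·eᵢ) eᵢ`, `u(t, x + s eᵢ) = u(t, x)`), and let `θ` be jointly
smooth, invariant along the `i`-th axis, and solve the (forced) heat equation
`∂ₜθ = νΔθ + φ` on `[a, b]` (one-sided time derivative within `[a, b]`). Then `w = θ eᵢ` with
ZERO pressure solves the forced linearised Navier–Stokes system along `u`,
`∂ₜw + (u·∇)w + (w·∇)u = νΔw − ∇0 + φ eᵢ`: both advection terms vanish identically
(`(u·∇)(θeᵢ) = uᵢ ∂ᵢθ eᵢ = 0`, `((θeᵢ)·∇)u = θ ∂ᵢu = 0`). The streamwise (`k = 0`) block of the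
mode-by-mode decoupling of linear evolutions about shear flows (Bedrossian–Coti Zelati 2017 §1;
Drazin 2002 Ex. 8.8), for the linearised system of Temam 1997 Ch. VI (3.7)–(3.10).
[cite: Temam1997, Ch. VI §3.1 (3.7)-(3.10)] [cite: BedrossianCotiZelati2017, §1 (projection P_k onto the k-th streamwise mode)] -/
theorem Torus.linearisedNSForced_of_parallel_heat (hab : a < b)
    (hu : Torus.IsSmoothSpaceTimeOn (Icc a b) u)
    (hdir : ∀ t ∈ Icc a b, ∀ x, u t x = (u t x i) • EuclideanSpace.single i (1 : ℝ))
    (hinv : ∀ t ∈ Icc a b, ∀ (s : UnitAddCircle) (x : UnitAddTorus d), u t (x + Pi.single i s) = u t x)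
    (hθ : Torus.IsSmoothSpaceTimeOn (Icc a b) θ)
    (hθinv : ∀ t ∈ Icc a b, ∀ (s : UnitAddCircle) (x : UnitAddTorus d), θ t (x + Pi.single i s) = θ t x)
    (hheat : ∀ t ∈ Icc a b, ∀ x,
      Torus.timeDerivWithin (Icc a b) θ t x = ν * Torus.laplacian (θ t) x + φ t x)
    {t : ℝ} (ht : t ∈ Icc a b) (x : UnitAddTorus d) :
    Torus.timeDerivWithin (Icc a b) (fun s y => θ s y • EuclideanSpace.single i (1 : ℝ)) t x +
        Torus.convect (u t) (fun y => θ t y • EuclideanSpace.single i (1 : ℝ)) x +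
        Torus.convect (fun y => θ t y • EuclideanSpace.single i (1 : ℝ)) (u t) x =
      ν • Torus.laplacian (fun y => θ t y • EuclideanSpace.single i (1 : ℝ)) x -
        Torus.gradient (fun _ : UnitAddTorus d => (0 : ℝ)) x + φ t x • EuclideanSpace.single i (1 : ℝ) := by
  set e : EuclideanSpace ℝ d := EuclideanSpace.single i (1 : ℝ) with he
  have hθt : Torus.IsSmooth (θ t) := hθ.isSmooth_slice ht
  have hut : Torus.IsSmooth (u t) := hu.isSmooth_slice ht
  have hD : Torus.timeDerivWithin (Icc a b) (fun s y => θ s y • e) t x =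
      (Torus.timeDerivWithin (Icc a b) θ t x) • e :=
    Torus.timeDerivWithin_smul_const_of_isSmoothSpaceTimeOn hθ (uniqueDiffOn_Icc hab) e ht x
  have hA : Torus.convect (u t) (fun y => θ t y • e) x = 0 := by
    rw [Torus.convect_of_parallel ((hθt.smul' (Torus.isSmooth_const e)).isContDiff (by simp)) i
        (hdir t ht x),
      Torus.partialDeriv_smul_const_of_isContDiff (hθt.isContDiff (by simp)) e i x,
      Torus.partialDeriv_eq_zero_of_forall_add_single (hθinv t ht), zero_smul, smul_zero]
  have hB : Torus.convect (fun y => θ t y • e) (u t) x = 0 := by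
    rw [Torus.convect_of_parallel (hut.isContDiff (by simp)) i (c := θ t x) rfl,
      Torus.partialDeriv_eq_zero_of_forall_add_single (hinv t ht), smul_zero]
  have hL : Torus.laplacian (fun y => θ t y • e) x = (Torus.laplacian (θ t) x) • e :=
    Torus.laplacian_smul_const_of_isSmooth hθt e x
  have hG : Torus.gradient (fun _ : UnitAddTorus d => (0 : ℝ)) x = 0 := by
    change _root_.gradient (Torus.liftAt (fun _ : UnitAddTorus d => (0 : ℝ)) x) 0 = 0
    have : Torus.liftAt (fun _ : UnitAddTorus d => (0 : ℝ)) x = fun _ => 0 := by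
      funext w; simp only [Torus.liftAt_apply]
    rw [this]
    exact gradient_fun_const _ _
  rw [hD, hA, hB, hL, hG, hheat t ht x, add_zero, add_zero, sub_zero, add_smul, mul_smul]

/-- The unforced case of `Torus.linearisedNSForced_of_parallel_heat`: `∂ₜθ = νΔθ` gives a
solution `(θ eᵢ, 0)` of the homogeneous linearised system along the parallel shear `u`.
[cite: Temam1997, Ch. VI §3.1 (3.7)-(3.10)] -/
theorem Torus.linearisedNS_of_parallel_heat (hab : a < b)
    (hu : Torus.IsSmoothSpaceTimeOn (Icc a b) u)
    (hdir : ∀ t ∈ Icc a b, ∀ x, u t x = (u t x i) • EuclideanSpace.single i (1 : ℝ))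
    (hinv : ∀ t ∈ Icc a b, ∀ (s : UnitAddCircle) (x : UnitAddTorus d), u t (x + Pi.single i s) = u t x)
    (hθ : Torus.IsSmoothSpaceTimeOn (Icc a b) θ)
    (hθinv : ∀ t ∈ Icc a b, ∀ (s : UnitAddCircle) (x : UnitAddTorus d), θ t (x + Pi.single i s) = θ t x)
    (hheat : ∀ t ∈ Icc a b, ∀ x, Torus.timeDerivWithin (Icc a b) θ t x = ν * Torus.laplacian (θ t) x)
    {t : ℝ} (ht : t ∈ Icc a b) (x : UnitAddTorus d) :
    Torus.timeDerivWithin (Icc a b) (fun s y => θ s y • EuclideanSpace.single i (1 : ℝ)) t x +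
        Torus.convect (u t) (fun y => θ t y • EuclideanSpace.single i (1 : ℝ)) x +
        Torus.convect (fun y => θ t y • EuclideanSpace.single i (1 : ℝ)) (u t) x =
      ν • Torus.laplacian (fun y => θ t y • EuclideanSpace.single i (1 : ℝ)) x -
        Torus.gradient (fun _ : UnitAddTorus d => (0 : ℝ)) x := by
  have h := Torus.linearisedNSForced_of_parallel_heat (φ := fun _ _ => (0 : ℝ)) hab hu hdir hinv hθ hθinv
    (fun s hs y => by rw [hheat s hs y, add_zero]) ht x
  rwa [zero_smul, add_zero] at h

/-- A streamwise-invariant solution of the heat equation is a classical transported scalar ALONG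
the parallel shear itself: `∂ₜθ + u·∇θ = νΔθ` with `u·∇θ = uᵢ ∂ᵢθ = 0`
(`Torus.IsClassicalScalarTransportOn (Icc a b) ν u θ`; the shear is divergence free). So the
tree's classical scalar machinery (energy identity, maximum principle, fibre damping, Fourier
coefficient equation `IsClassicalScalarTransportOn.mFourierCoeff_timeDerivWithin_eq`) applies to
the amplitude. [cite: BedrossianCotiZelati2017, §1 (streamwise mode of a shear flow)] -/
theorem Torus.isClassicalScalarTransportOn_of_parallel_heat
    (hu : Torus.IsSmoothSpaceTimeOn (Icc a b) u)
    (hdir : ∀ t ∈ Icc a b, ∀ x, u t x = (u t x i) • EuclideanSpace.single i (1 : ℝ))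
    (hinv : ∀ t ∈ Icc a b, ∀ (s : UnitAddCircle) (x : UnitAddTorus d), u t (x + Pi.single i s) = u t x)
    (hθ : Torus.IsSmoothSpaceTimeOn (Icc a b) θ)
    (hθinv : ∀ t ∈ Icc a b, ∀ (s : UnitAddCircle) (x : UnitAddTorus d), θ t (x + Pi.single i s) = θ t x)
    (hheat : ∀ t ∈ Icc a b, ∀ x, Torus.timeDerivWithin (Icc a b) θ t x = ν * Torus.laplacian (θ t) x) :
    Torus.IsClassicalScalarTransportOn (Icc a b) ν u θ := by
  refine ⟨hu, hθ, fun t ht x => ?_, fun t ht => ?_⟩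
  · have hθ1 : Torus.IsContDiff 1 (θ t) := (hθ.isSmooth_slice ht).isContDiff (by simp)
    have hadv : ⟪u t x, Torus.gradient (θ t) x⟫_ℝ = 0 := by
      rw [real_inner_comm, Torus.inner_gradient_left, hdir t ht x, map_smul,
        ← Torus.partialDeriv_eq_fderiv_apply hθ1, Torus.partialDeriv_eq_zero_of_forall_add_single (hθinv t ht),
        smul_zero]
    rw [hadv, add_zero, hheat t ht x]
  · exact Torus.isDivFree_of_parallel_of_forall_add_single (hdir t ht) (hinv t ht)

end Structure

/-! ### Existence of the streamwise-invariant heat flow on `[a, b]` and the linearised package -/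

section Existence

variable {a b ν : ℝ}

/-- **Streamwise-invariant heat flow on `[a, b] × 𝕋^d`.** For `ν > 0`, `a < b` and a smooth `g`
invariant along the `i`-th axis there is `θ`, jointly smooth on `[a, b] × 𝕋^d`, invariant along the
`i`-th axis, with `∂ₜθ = νΔθ` (one-sided time derivative within `[a, b]`) and `θ(a) = g`: the tree's
classical well-posedness of the advection–diffusion equation with ZERO drift
(`Torus.exists_isClassicalScalarTransportOn_Icc`, Krylov 1996 Thm 9.2.3) on `[0, b − a]`, translated
in time; the invariance is inherited from the datum by uniqueness
(`Torus.IsClassicalScalarTransportOn.eq_of_eq` applied to the space-translated solution).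
[cite: Krylov1996, Thm. 9.2.3] -/
theorem Torus.exists_parallel_heat (hν : 0 < ν) (hab : a < b) (i : d) {g : UnitAddTorus d → ℝ}
    (hg : Torus.IsSmooth g)
    (hginv : ∀ (s : UnitAddCircle) (x : UnitAddTorus d), g (x + Pi.single i s) = g x) :
    ∃ θ : ℝ → UnitAddTorus d → ℝ, Torus.IsSmoothSpaceTimeOn (Icc a b) θ ∧ θ a = g ∧
      (∀ t ∈ Icc a b, ∀ (s : UnitAddCircle) (x : UnitAddTorus d), θ t (x + Pi.single i s) = θ t x) ∧
      (∀ t ∈ Icc a b, ∀ x, Torus.timeDerivWithin (Icc a b) θ t x = ν * Torus.laplacian (θ t) x) := by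
  have hT : 0 < b - a := sub_pos.2 hab
  set z : ℝ → UnitAddTorus d → EuclideanSpace ℝ d := fun _ _ => 0 with hz
  have hzs : Torus.IsSmoothSpaceTimeOn (Icc 0 (b - a)) z :=
    Torus.isSmoothSpaceTimeOn_const (Torus.isSmooth_const (d := d) (0 : EuclideanSpace ℝ d)) _
  have hzdiv : ∀ s ∈ Icc 0 (b - a), Torus.IsDivFree (z s) := fun s _ x => by
    simp [hz, Torus.divergence, Torus.partialDeriv, Torus.lineDeriv]
  obtain ⟨θ₀, hθ₀, hθ₀0⟩ := Torus.exists_isClassicalScalarTransportOn_Icc hν hT hzs hzdiv hg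
  -- invariance of `θ₀` along the `i`-th axis, by uniqueness
  have hinv₀ : ∀ t ∈ Icc 0 (b - a), ∀ (s : UnitAddCircle) (x : UnitAddTorus d),
      θ₀ t (x + Pi.single i s) = θ₀ t x := by
    intro t ht s x
    have htr := hθ₀.comp_add_right_space (Pi.single i s) (fun _ _ _ => by simp [hz])
    have h0 : (fun x => θ₀ 0 (x + Pi.single i s)) = θ₀ 0 := by
      funext y; rw [hθ₀0, hginv]
    have := Torus.IsClassicalScalarTransportOn.eq_of_eq hν.le htr hθ₀ h0 ht
    exact congrFun this x
  -- the heat equation for `θ₀` (zero drift)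
  have hheat₀ : ∀ t ∈ Icc 0 (b - a), ∀ x,
      Torus.timeDerivWithin (Icc 0 (b - a)) θ₀ t x = ν * Torus.laplacian (θ₀ t) x := by
    intro t ht x
    have h := hθ₀.transport t ht x
    rwa [show z t x = 0 from rfl, inner_zero_left, add_zero] at h
  -- translate `[0, b - a] → [a, b]`
  have hpre : (· + -a) ⁻¹' Icc (0 : ℝ) (b - a) = Icc a b := by
    rw [Torus.preimage_add_const_Icc']; congr 1 <;> ring
  refine ⟨fun t => θ₀ (t + -a), ?_, ?_, fun t ht s x => ?_, fun t ht x => ?_⟩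
  · have h := hθ₀.smooth_scalar.comp_add_const (-a)
    rwa [hpre] at h
  · show θ₀ (a + -a) = g
    rw [add_neg_cancel, hθ₀0]
  · exact hinv₀ (t + -a) (by rw [← hpre] at ht; exact ht) s x
  · have h1 := Torus.timeDerivWithin_comp_add_const (Icc (0 : ℝ) (b - a)) θ₀ (-a) t x
    rw [hpre] at h1
    rw [h1]
    exact hheat₀ (t + -a) (by rw [← hpre] at ht; exact ht) x

variable {i : d} {u : ℝ → UnitAddTorus d → EuclideanSpace ℝ d}

/-- **The classical linearised solution from parallel streamwise-invariant data is the heat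
flow.** For `ν > 0`, `a < b`, a jointly smooth parallel shear background `u ∥ eᵢ` invariant along
the `i`-th axis, and a smooth streamwise-invariant profile `g`, there is `θ` (jointly smooth,
streamwise invariant, `∂ₜθ = νΔθ`, `θ(a) = g`) such that `w = θ eᵢ`, `q = 0` is a classical
solution of the linearised Navier–Stokes system `∂ₜw + (u·∇)w + (w·∇)u = νΔw − ∇q`, `div w = 0`
on `[a, b] × 𝕋^d` with `w(a) = g eᵢ` — in the unbundled form consumed by
`Torus.linearisedNS_unique` / `SawtoothCascade.K2PhaseGrowthClassical`.
[cite: Temam1997, Ch. VI §3.1 (3.7)-(3.11)] -/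
theorem Torus.exists_linearisedNS_parallel (hν : 0 < ν) (hab : a < b)
    (hu : Torus.IsSmoothSpaceTimeOn (Icc a b) u)
    (hdir : ∀ t ∈ Icc a b, ∀ x, u t x = (u t x i) • EuclideanSpace.single i (1 : ℝ))
    (hinv : ∀ t ∈ Icc a b, ∀ (s : UnitAddCircle) (x : UnitAddTorus d), u t (x + Pi.single i s) = u t x)
    {g : UnitAddTorus d → ℝ} (hg : Torus.IsSmooth g)
    (hginv : ∀ (s : UnitAddCircle) (x : UnitAddTorus d), g (x + Pi.single i s) = g x) :
    ∃ θ : ℝ → UnitAddTorus d → ℝ,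
      Torus.IsSmoothSpaceTimeOn (Icc a b) θ ∧ θ a = g ∧
      (∀ t ∈ Icc a b, ∀ (s : UnitAddCircle) (x : UnitAddTorus d), θ t (x + Pi.single i s) = θ t x) ∧
      (∀ t ∈ Icc a b, ∀ x, Torus.timeDerivWithin (Icc a b) θ t x = ν * Torus.laplacian (θ t) x) ∧
      Torus.IsSmoothSpaceTimeOn (Icc a b) (fun t x => θ t x • EuclideanSpace.single i (1 : ℝ)) ∧
      (∀ t ∈ Icc a b, Torus.IsDivFree (fun x => θ t x • EuclideanSpace.single i (1 : ℝ))) ∧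
      (∀ t ∈ Icc a b, ∀ x,
        Torus.timeDerivWithin (Icc a b) (fun s y => θ s y • EuclideanSpace.single i (1 : ℝ)) t x +
            Torus.convect (u t) (fun y => θ t y • EuclideanSpace.single i (1 : ℝ)) x +
            Torus.convect (fun y => θ t y • EuclideanSpace.single i (1 : ℝ)) (u t) x =
          ν • Torus.laplacian (fun y => θ t y • EuclideanSpace.single i (1 : ℝ)) x -
            Torus.gradient (fun _ : UnitAddTorus d => (0 : ℝ)) x) ∧
      (fun x => θ a x • EuclideanSpace.single i (1 : ℝ)) = fun x => g x • EuclideanSpace.single i (1 : ℝ) := by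
  obtain ⟨θ, hθ, hθa, hθinv, hheat⟩ := Torus.exists_parallel_heat hν hab i hg hginv
  refine ⟨θ, hθ, hθa, hθinv, hheat,
    hθ.smul (Torus.isSmoothSpaceTimeOn_const (Torus.isSmooth_const (d := d) (EuclideanSpace.single i (1 : ℝ))) _),
    fun t ht => Torus.isDivFree_smul_single_of_forall_add_single (hθinv t ht),
    fun t ht x => Torus.linearisedNS_of_parallel_heat hab hu hdir hinv hθ hθinv hheat ht x, ?_⟩
  funext x
  rw [hθa]

/-- **Uniqueness form.** Along a jointly smooth parallel streamwise-invariant shear `u ∥ eᵢ`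
(`ν > 0`, `a < b`), EVERY classical solution `(w, q)` of the linearised Navier–Stokes system on
`[a, b] × 𝕋^d` whose datum is parallel and streamwise invariant, `w(a) = g eᵢ`, is the heat flow:
`w(t) = θ(t) eᵢ` on `[a, b]` with `θ` as in `Torus.exists_parallel_heat` (`∂ₜθ = νΔθ`,
`θ(a) = g`, `θ` streamwise invariant) — by `Torus.linearisedNS_unique` (Temam 1997, Ch. VI (3.11):
the linearised problem "possesses a unique solution"). In particular `w(t)` stays parallel to `eᵢ`
and invariant along the `i`-th axis. [cite: Temam1997, Ch. VI §3.1 (3.11)] -/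
theorem Torus.linearisedNS_parallel_unique (hν : 0 < ν) (hab : a < b)
    (hu : Torus.IsSmoothSpaceTimeOn (Icc a b) u)
    (hdir : ∀ t ∈ Icc a b, ∀ x, u t x = (u t x i) • EuclideanSpace.single i (1 : ℝ))
    (hinv : ∀ t ∈ Icc a b, ∀ (s : UnitAddCircle) (x : UnitAddTorus d), u t (x + Pi.single i s) = u t x)
    {g : UnitAddTorus d → ℝ} (hg : Torus.IsSmooth g)
    (hginv : ∀ (s : UnitAddCircle) (x : UnitAddTorus d), g (x + Pi.single i s) = g x)
    {w : ℝ → UnitAddTorus d → EuclideanSpace ℝ d} {q : ℝ → UnitAddTorus d → ℝ}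
    (hw : Torus.IsSmoothSpaceTimeOn (Icc a b) w) (hq : Torus.IsSmoothSpaceTimeOn (Icc a b) q)
    (hwdiv : ∀ t ∈ Icc a b, Torus.IsDivFree (w t))
    (hlin : ∀ t ∈ Icc a b, ∀ x, Torus.timeDerivWithin (Icc a b) w t x + Torus.convect (u t) (w t) x +
      Torus.convect (w t) (u t) x = ν • Torus.laplacian (w t) x - Torus.gradient (q t) x)
    (h0 : w a = fun x => g x • EuclideanSpace.single i (1 : ℝ)) :
    ∃ θ : ℝ → UnitAddTorus d → ℝ,
      Torus.IsSmoothSpaceTimeOn (Icc a b) θ ∧ θ a = g ∧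
      (∀ t ∈ Icc a b, ∀ (s : UnitAddCircle) (x : UnitAddTorus d), θ t (x + Pi.single i s) = θ t x) ∧
      (∀ t ∈ Icc a b, ∀ x, Torus.timeDerivWithin (Icc a b) θ t x = ν * Torus.laplacian (θ t) x) ∧
      ∀ t ∈ Icc a b, w t = fun x => θ t x • EuclideanSpace.single i (1 : ℝ) := by
  obtain ⟨θ, hθ, hθa, hθinv, hheat, hws, hwdiv', hlin', h0'⟩ :=
    Torus.exists_linearisedNS_parallel hν hab hu hdir hinv hg hginv
  refine ⟨θ, hθ, hθa, hθinv, hheat, fun t ht => ?_⟩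
  have hudiv : ∀ s ∈ Icc a b, Torus.IsDivFree (u s) := fun s hs =>
    Torus.isDivFree_of_parallel_of_forall_add_single (hdir s hs) (hinv s hs)
  have hq0 : Torus.IsSmoothSpaceTimeOn (Icc a b) (fun (_ : ℝ) (_ : UnitAddTorus d) => (0 : ℝ)) :=
    Torus.isSmoothSpaceTimeOn_const (Torus.isSmooth_const (d := d) (0 : ℝ)) _
  exact Torus.linearisedNS_unique hν.le hu hudiv hw hq hwdiv hlin hws hq0 hwdiv'
    (fun s hs y => hlin' s hs y) (by rw [h0, ← h0']) ht

end Existence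

/-! ### The forced case: parallel streamwise-invariant SOURCES generate the forced heat flow -/

section Forced

variable {a b ν : ℝ}

/-- A classical FORCED transported scalar along a drift invariant under a space translation, with a
source invariant under it, translated by it, is again one (same window, diffusivity, drift, source):
translation invariance of `∂ₜ + b·∇ − κΔ`. [cite: Krylov1996, Thm. 9.2.3 (translation invariance of the forced problem)] -/
theorem Torus.IsClassicalScalarTransportForcedOn.comp_add_right_space {S : Set ℝ} {κ : ℝ}
    {bd : ℝ → UnitAddTorus d → EuclideanSpace ℝ d} {src θ : ℝ → UnitAddTorus d → ℝ}
    (h : Torus.IsClassicalScalarTransportForcedOn S κ bd src θ) (v : UnitAddTorus d)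
    (hb : ∀ t ∈ S, ∀ x, bd t (x + v) = bd t x) (hsrc : ∀ t ∈ S, ∀ x, src t (x + v) = src t x) :
    Torus.IsClassicalScalarTransportForcedOn S κ bd src (fun t x => θ t (x + v)) := by
  refine ⟨h.smooth_velocity, h.smooth_source, h.smooth_scalar.comp_add_right_space v,
    fun t ht x => ?_, h.divFree⟩
  rw [Torus.timeDerivWithin_comp_add_right_space, gradient_comp_add_right',
    laplacian_comp_add_right', ← hb t ht x, ← hsrc t ht x]
  exact h.transport t ht (x + v)

/-- **Uniqueness for the forced linearised Navier–Stokes equation on `[a, b] × 𝕋^d`.** Two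
classical solutions along the same smooth divergence-free field `u` with the SAME source `g` and the
same datum at `t = a` coincide on `[a, b]` (linearity `Torus.linearisedNSForced_sub_eq` and the
homogeneous `Torus.linearisedNS_eq_zero`; Temam 1997, Ch. VI (3.11)). [cite: Temam1997, Ch. VI §3.1 (3.11)] -/
theorem Torus.linearisedNSForced_unique (hν : 0 ≤ ν) (hab : a < b)
    {u w₁ w₂ g : ℝ → UnitAddTorus d → EuclideanSpace ℝ d} {q₁ q₂ : ℝ → UnitAddTorus d → ℝ}
    (hu : Torus.IsSmoothSpaceTimeOn (Icc a b) u) (hudiv : ∀ t ∈ Icc a b, Torus.IsDivFree (u t))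
    (hw₁ : Torus.IsSmoothSpaceTimeOn (Icc a b) w₁) (hq₁ : Torus.IsSmoothSpaceTimeOn (Icc a b) q₁)
    (hwdiv₁ : ∀ t ∈ Icc a b, Torus.IsDivFree (w₁ t))
    (hlin₁ : ∀ t ∈ Icc a b, ∀ x, Torus.timeDerivWithin (Icc a b) w₁ t x + Torus.convect (u t) (w₁ t) x +
      Torus.convect (w₁ t) (u t) x = ν • Torus.laplacian (w₁ t) x - Torus.gradient (q₁ t) x + g t x)
    (hw₂ : Torus.IsSmoothSpaceTimeOn (Icc a b) w₂) (hq₂ : Torus.IsSmoothSpaceTimeOn (Icc a b) q₂)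
    (hwdiv₂ : ∀ t ∈ Icc a b, Torus.IsDivFree (w₂ t))
    (hlin₂ : ∀ t ∈ Icc a b, ∀ x, Torus.timeDerivWithin (Icc a b) w₂ t x + Torus.convect (u t) (w₂ t) x +
      Torus.convect (w₂ t) (u t) x = ν • Torus.laplacian (w₂ t) x - Torus.gradient (q₂ t) x + g t x)
    (h0 : w₁ a = w₂ a) {t : ℝ} (ht : t ∈ Icc a b) : w₁ t = w₂ t := by
  have hdiff := fun s hs y => Torus.linearisedNSForced_sub_eq (u := u) (ν := ν) hw₁ hq₁ hlin₁ hw₂ hq₂ hlin₂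
    hab (t := s) hs y
  have hdiv : ∀ s ∈ Icc a b, Torus.IsDivFree (fun y => w₁ s y - w₂ s y) := by
    intro s hs x
    have h12 : (fun y => w₁ s y - w₂ s y) = w₁ s - w₂ s := rfl
    rw [h12, Torus.divergence_sub ((hw₁.isSmooth_slice hs).isContDiff (by simp))
      ((hw₂.isSmooth_slice hs).isContDiff (by simp)), hwdiv₁ s hs x, hwdiv₂ s hs x, sub_zero]
  have hz := Torus.linearisedNS_eq_zero hν hu hudiv (hw₁.sub hw₂) (hq₁.sub hq₂) hdiv
    (fun s hs y => by
      have h := hdiff s hs y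
      rwa [sub_self, add_zero] at h)
    (by funext y; simp [h0]) ht
  funext y
  have := congrFun hz y
  exact sub_eq_zero.1 this

/-- **Streamwise-invariant FORCED heat flow on `[a, b] × 𝕋^d`.** For `ν > 0`, `a < b`, a jointly
smooth source `φ` and a smooth datum `g`, both invariant along the `i`-th axis, there is `θ` jointly
smooth on `[a, b] × 𝕋^d`, invariant along the `i`-th axis, with `∂ₜθ = νΔθ + φ` (one-sided time
derivative within `[a, b]`) and `θ(a) = g` (the tree's classical well-posedness of the forced
advection–diffusion equation with zero drift, `Torus.exists_unique_isClassicalScalarTransportForcedOn_holds`,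
Krylov 1996 Thm 9.2.3, on `[0, b − a]`, translated; invariance by its uniqueness clause).
[cite: Krylov1996, Thm. 9.2.3] -/
theorem Torus.exists_parallel_heatForced (hν : 0 < ν) (hab : a < b) (i : d)
    {φ : ℝ → UnitAddTorus d → ℝ} (hφ : Torus.IsSmoothSpaceTimeOn (Icc a b) φ)
    (hφinv : ∀ t ∈ Icc a b, ∀ (s : UnitAddCircle) (x : UnitAddTorus d), φ t (x + Pi.single i s) = φ t x)
    {g : UnitAddTorus d → ℝ} (hg : Torus.IsSmooth g)
    (hginv : ∀ (s : UnitAddCircle) (x : UnitAddTorus d), g (x + Pi.single i s) = g x) :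
    ∃ θ : ℝ → UnitAddTorus d → ℝ, Torus.IsSmoothSpaceTimeOn (Icc a b) θ ∧ θ a = g ∧
      (∀ t ∈ Icc a b, ∀ (s : UnitAddCircle) (x : UnitAddTorus d), θ t (x + Pi.single i s) = θ t x) ∧
      (∀ t ∈ Icc a b, ∀ x,
        Torus.timeDerivWithin (Icc a b) θ t x = ν * Torus.laplacian (θ t) x + φ t x) := by
  have hT : 0 < b - a := sub_pos.2 hab
  set z : ℝ → UnitAddTorus d → EuclideanSpace ℝ d := fun _ _ => 0 with hz
  have hzs : Torus.IsSmoothSpaceTimeOn (Icc 0 (b - a)) z :=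
    Torus.isSmoothSpaceTimeOn_const (Torus.isSmooth_const (d := d) (0 : EuclideanSpace ℝ d)) _
  have hzdiv : ∀ s ∈ Icc 0 (b - a), Torus.IsDivFree (z s) := fun s _ x => by
    simp [hz, Torus.divergence, Torus.partialDeriv, Torus.lineDeriv]
  -- the source translated to `[0, b - a]`
  have hpre₁ : (· + a) ⁻¹' Icc a b = Icc (0 : ℝ) (b - a) := by
    rw [Torus.preimage_add_const_Icc', sub_self]
  have hφ₀ : Torus.IsSmoothSpaceTimeOn (Icc 0 (b - a)) (fun t => φ (t + a)) := by
    have h := hφ.comp_add_const a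
    rwa [hpre₁] at h
  obtain ⟨θ₀, hθ₀, hθ₀0, huniq⟩ :=
    Torus.exists_unique_isClassicalScalarTransportForcedOn_holds hν hT hzs hzdiv hφ₀ hg
  -- invariance by uniqueness
  have hinv₀ : ∀ t ∈ Icc 0 (b - a), ∀ (s : UnitAddCircle) (x : UnitAddTorus d),
      θ₀ t (x + Pi.single i s) = θ₀ t x := by
    intro t ht s x
    have htr := hθ₀.comp_add_right_space (Pi.single i s) (fun _ _ _ => by simp [hz])
      (fun r hr y => hφinv (r + a) ⟨by linarith [hr.1], by linarith [hr.2]⟩ s y)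
    have h0 : (fun x => θ₀ 0 (x + Pi.single i s)) = g := by
      funext y; rw [hθ₀0, hginv]
    have := huniq _ htr h0 t ht
    exact congrFun this x
  have hheat₀ : ∀ t ∈ Icc 0 (b - a), ∀ x,
      Torus.timeDerivWithin (Icc 0 (b - a)) θ₀ t x = ν * Torus.laplacian (θ₀ t) x + φ (t + a) x := by
    intro t ht x
    have h := hθ₀.transport t ht x
    rwa [show z t x = 0 from rfl, inner_zero_left, add_zero] at h
  have hpre : (· + -a) ⁻¹' Icc (0 : ℝ) (b - a) = Icc a b := by
    rw [Torus.preimage_add_const_Icc']; congr 1 <;> ring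
  refine ⟨fun t => θ₀ (t + -a), ?_, ?_, fun t ht s x => ?_, fun t ht x => ?_⟩
  · have h := hθ₀.smooth_scalar.comp_add_const (-a)
    rwa [hpre] at h
  · show θ₀ (a + -a) = g
    rw [add_neg_cancel, hθ₀0]
  · exact hinv₀ (t + -a) (by rw [← hpre] at ht; exact ht) s x
  · have h1 := Torus.timeDerivWithin_comp_add_const (Icc (0 : ℝ) (b - a)) θ₀ (-a) t x
    rw [hpre] at h1
    rw [h1, hheat₀ (t + -a) (by rw [← hpre] at ht; exact ht) x, neg_add_cancel_right]

variable {i : d} {u : ℝ → UnitAddTorus d → EuclideanSpace ℝ d}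

/-- **The forced linearised response to a parallel streamwise-invariant source is the forced heat
flow.** Along a jointly smooth parallel shear `u ∥ eᵢ` invariant along the `i`-th axis (`ν > 0`,
`a < b`), for a source `φ eᵢ` and a datum `g eᵢ` with `φ`, `g` invariant along the `i`-th axis there
is `θ` (jointly smooth, streamwise invariant, `∂ₜθ = νΔθ + φ`, `θ(a) = g`) with `(θ eᵢ, 0)` a
classical solution of the FORCED linearised system `∂ₜw + (u·∇)w + (w·∇)u = νΔw − ∇q + φ eᵢ`,
`div w = 0`, `w(a) = g eᵢ`; and EVERY classical solution `(w, q)` of that forced system with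
`w(a) = g eᵢ` equals it: `w(t) = θ(t) eᵢ` on `[a, b]` (`Torus.linearisedNSForced_unique`). This is
how the linearised response of the sawtooth cascade is generated on each half-slot (source
`νΔū = ν·rate·U″ e_∥`). [cite: Temam1997, Ch. VI §3.1 (3.7)-(3.11)] -/
theorem Torus.linearisedNSForced_parallel_unique (hν : 0 < ν) (hab : a < b)
    (hu : Torus.IsSmoothSpaceTimeOn (Icc a b) u)
    (hdir : ∀ t ∈ Icc a b, ∀ x, u t x = (u t x i) • EuclideanSpace.single i (1 : ℝ))
    (hinv : ∀ t ∈ Icc a b, ∀ (s : UnitAddCircle) (x : UnitAddTorus d), u t (x + Pi.single i s) = u t x)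
    {φ : ℝ → UnitAddTorus d → ℝ} (hφ : Torus.IsSmoothSpaceTimeOn (Icc a b) φ)
    (hφinv : ∀ t ∈ Icc a b, ∀ (s : UnitAddCircle) (x : UnitAddTorus d), φ t (x + Pi.single i s) = φ t x)
    {g : UnitAddTorus d → ℝ} (hg : Torus.IsSmooth g)
    (hginv : ∀ (s : UnitAddCircle) (x : UnitAddTorus d), g (x + Pi.single i s) = g x) :
    ∃ θ : ℝ → UnitAddTorus d → ℝ,
      Torus.IsSmoothSpaceTimeOn (Icc a b) θ ∧ θ a = g ∧
      (∀ t ∈ Icc a b, ∀ (s : UnitAddCircle) (x : UnitAddTorus d), θ t (x + Pi.single i s) = θ t x) ∧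
      (∀ t ∈ Icc a b, ∀ x,
        Torus.timeDerivWithin (Icc a b) θ t x = ν * Torus.laplacian (θ t) x + φ t x) ∧
      Torus.IsSmoothSpaceTimeOn (Icc a b) (fun t x => θ t x • EuclideanSpace.single i (1 : ℝ)) ∧
      (∀ t ∈ Icc a b, Torus.IsDivFree (fun x => θ t x • EuclideanSpace.single i (1 : ℝ))) ∧
      (∀ t ∈ Icc a b, ∀ x,
        Torus.timeDerivWithin (Icc a b) (fun s y => θ s y • EuclideanSpace.single i (1 : ℝ)) t x +
            Torus.convect (u t) (fun y => θ t y • EuclideanSpace.single i (1 : ℝ)) x +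
            Torus.convect (fun y => θ t y • EuclideanSpace.single i (1 : ℝ)) (u t) x =
          ν • Torus.laplacian (fun y => θ t y • EuclideanSpace.single i (1 : ℝ)) x -
            Torus.gradient (fun _ : UnitAddTorus d => (0 : ℝ)) x + φ t x • EuclideanSpace.single i (1 : ℝ)) ∧
      ∀ {w : ℝ → UnitAddTorus d → EuclideanSpace ℝ d} {q : ℝ → UnitAddTorus d → ℝ},
        Torus.IsSmoothSpaceTimeOn (Icc a b) w → Torus.IsSmoothSpaceTimeOn (Icc a b) q →
        (∀ t ∈ Icc a b, Torus.IsDivFree (w t)) →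
        (∀ t ∈ Icc a b, ∀ x, Torus.timeDerivWithin (Icc a b) w t x + Torus.convect (u t) (w t) x +
          Torus.convect (w t) (u t) x = ν • Torus.laplacian (w t) x - Torus.gradient (q t) x +
            φ t x • EuclideanSpace.single i (1 : ℝ)) →
        (w a = fun x => g x • EuclideanSpace.single i (1 : ℝ)) →
        ∀ t ∈ Icc a b, w t = fun x => θ t x • EuclideanSpace.single i (1 : ℝ) := by
  obtain ⟨θ, hθ, hθa, hθinv, hheat⟩ := Torus.exists_parallel_heatForced hν hab i hφ hφinv hg hginv
  have hws : Torus.IsSmoothSpaceTimeOn (Icc a b) (fun t x => θ t x • EuclideanSpace.single i (1 : ℝ)) :=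
    hθ.smul (Torus.isSmoothSpaceTimeOn_const (Torus.isSmooth_const (d := d) (EuclideanSpace.single i (1 : ℝ))) _)
  have hwdiv' : ∀ t ∈ Icc a b, Torus.IsDivFree (fun x => θ t x • EuclideanSpace.single i (1 : ℝ)) :=
    fun t ht => Torus.isDivFree_smul_single_of_forall_add_single (hθinv t ht)
  have hlin' := fun t ht x =>
    Torus.linearisedNSForced_of_parallel_heat hab hu hdir hinv hθ hθinv hheat (t := t) ht x
  have hudiv : ∀ s ∈ Icc a b, Torus.IsDivFree (u s) := fun s hs =>
    Torus.isDivFree_of_parallel_of_forall_add_single (hdir s hs) (hinv s hs)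
  have hq0 : Torus.IsSmoothSpaceTimeOn (Icc a b) (fun (_ : ℝ) (_ : UnitAddTorus d) => (0 : ℝ)) :=
    Torus.isSmoothSpaceTimeOn_const (Torus.isSmooth_const (d := d) (0 : ℝ)) _
  refine ⟨θ, hθ, hθa, hθinv, hheat, hws, hwdiv', hlin', ?_⟩
  intro w q hw hq hwdiv hlin h0 t ht
  refine Torus.linearisedNSForced_unique (g := fun t x => φ t x • EuclideanSpace.single i (1 : ℝ))
    hν.le hab hu hudiv hw hq hwdiv hlin hws hq0 hwdiv' (fun s hs y => hlin' s hs y) ?_ ht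
  rw [h0]; funext x; rw [hθa]

end Forced

end Literature.Analysis.FluidPDE

end
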